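import Summits.SmoothPoincare4.SmoothPoincare4.Theorems.SymplecticOrigamiGromovRecognitionRelEndStubFlatLeavesAux
import Mathlib.Geometry.Manifold.LocalDiffeomorph
import Mathlib.Analysis.Complex.Basic

/-!
# The complex coordinates of a cap chart are smooth `J`-holomorphic functions
(registered helper `helper_chartCoordinatesHolomorphic` of line `cross-cap-laurent`, crux
`GromovRecognitionRelEnd`, item stmt-SmoothPoincare4-11009)

In the wedge cap `X`, a cap chart `η : D → X` (`D ⊆ ℝ⁴` open, `η` an injective `C^∞` local
diffeomorphism on `D`) intertwines the product complex structure `i ⊕ i` of `ℝ⁴ = ℂ²` (the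
rotation `q ↦ (-q 1, q 0, -q 3, q 2)`) with the almost complex structure `JX` of `X`.  Then the
two complex coordinate functions `T₁ = (p 0 + i p 1) ∘ η⁻¹` and `T₂ = (p 2 + i p 3) ∘ η⁻¹`
(`η⁻¹ := Function.invFunOn η D`) are `C^∞` on the open image `η '' D` and `JX`-holomorphic:
`dT (JX w) = i · dT w`.  This is the local model that turns intersections of `JX`-curves with the
spheres at infinity into zeros of holomorphic functions.

Proof: openness of `η '' D`, smoothness of `η⁻¹` at the points of the image and the transfer of
holomorphicity to `η⁻¹` (`d(η⁻¹) (JX w) = (i ⊕ i) (d(η⁻¹) w)`) come from the generic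
`FlatLeaves` file (`…StubFlatLeavesAux`); composing with the real continuous linear coordinate
maps `ℝ⁴ → ℂ`, `p ↦ p 0 + i p 1` / `p ↦ p 2 + i p 3`, which intertwine `i ⊕ i` with `i`, gives
the claim by the chain rule.

References: D. McDuff, D. Salamon, *Introduction to Symplectic Topology*, 3rd ed. (2017), §2.5,
§4.5 [McDuffSalamon2017]; J. M. Lee, *Introduction to Smooth Manifolds*, 2nd ed. (2013),
Prop. 4.22 [LeeSmoothManifolds2013].
-/

noncomputable section

-- the registered namespace `Summit.SmoothPoincare4.SmoothPoincare4.Theorems…` repeats a component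
set_option linter.dupNamespace false

open scoped Manifold ContDiff Topology
open Set Function Filter

namespace Summit.SmoothPoincare4.SmoothPoincare4.Theorems.GromovRecognitionRelEnd.CrossCapLaurent

namespace FlatLeaves

/-- **A real-linear coordinate of a holomorphic chart intertwining `i ⊕ i` with `i` is a smooth
`JX`-holomorphic function on the image.**  If `JX ∘ dη = dη ∘ (i ⊕ i)` on the open set `D`
(`η` an injective `C^∞` local diffeomorphism on `D`) and `L : ℝ⁴ →L[ℝ] ℂ` satisfies
`L ∘ (i ⊕ i) = i L`, then `L ∘ η⁻¹` is `C^∞` on `η '' D` and `d(L ∘ η⁻¹) (JX w) = i d(L ∘ η⁻¹) w`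
there. [cite: McDuffSalamon2017, §2.5] -/
theorem contMDiffOn_and_hol_clm_comp_invFunOn {X : Type*} [TopologicalSpace X]
    [ChartedSpace (EuclideanSpace ℝ (Fin 4)) X]
    {JX : ∀ y : X, TangentSpace (𝓡 4) y →L[ℝ] TangentSpace (𝓡 4) y}
    {η : EuclideanSpace ℝ (Fin 4) → X} {D : Set (EuclideanSpace ℝ (Fin 4))} (hD : IsOpen D)
    (hη : IsLocalDiffeomorphOn 𝓘(ℝ, EuclideanSpace ℝ (Fin 4)) (𝓡 4) ∞ η D) (hinj : InjOn η D)
    (hhol : ∀ p ∈ D, ∀ q : EuclideanSpace ℝ (Fin 4),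
      JX (η p) (mfderiv 𝓘(ℝ, EuclideanSpace ℝ (Fin 4)) (𝓡 4) η p q) =
        mfderiv 𝓘(ℝ, EuclideanSpace ℝ (Fin 4)) (𝓡 4) η p (WithLp.toLp 2 ![-(q 1), q 0, -(q 3), q 2]))
    (L : EuclideanSpace ℝ (Fin 4) →L[ℝ] ℂ)
    (hL : ∀ q : EuclideanSpace ℝ (Fin 4),
      L (WithLp.toLp 2 ![-(q 1), q 0, -(q 3), q 2]) = Complex.I * L q) :
    ContMDiffOn (𝓡 4) 𝓘(ℝ, ℂ) ∞ (fun y => L (invFunOn η D y)) (η '' D) ∧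
      ∀ y ∈ η '' D, ∀ w : TangentSpace (𝓡 4) y,
        (show ℂ from mfderiv (𝓡 4) 𝓘(ℝ, ℂ) (fun y => L (invFunOn η D y)) y (JX y w)) =
          Complex.I * (show ℂ from mfderiv (𝓡 4) 𝓘(ℝ, ℂ) (fun y => L (invFunOn η D y)) y w) := by
  -- `η⁻¹` is `C^∞` at the points of the image, hence so is `L ∘ η⁻¹`
  have hsm : ∀ y ∈ η '' D, ContMDiffAt (𝓡 4) 𝓘(ℝ, ℂ) ∞ (fun y => L (invFunOn η D y)) y :=
    fun y hy => L.contMDiff.contMDiffAt.comp y (contMDiffAt_invFunOn_of_mem hD hη hinj hy)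
  refine ⟨fun y hy => (hsm y hy).contMDiffWithinAt, ?_⟩
  rintro y ⟨p, hp, rfl⟩ w
  -- the chain rule: `d(L ∘ η⁻¹) = L ∘ d(η⁻¹)` at `η p`
  have hg : MDifferentiableAt (𝓡 4) 𝓘(ℝ, EuclideanSpace ℝ (Fin 4)) (invFunOn η D) (η p) :=
    (contMDiffAt_invFunOn hD hη hinj hp).mdifferentiableAt (by simp)
  have hcomp : HasMFDerivAt (𝓡 4) 𝓘(ℝ, ℂ) (fun y => L (invFunOn η D y)) (η p)
      ((L : EuclideanSpace ℝ (Fin 4) →L[ℝ] ℂ).comp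
        (mfderiv (𝓡 4) 𝓘(ℝ, EuclideanSpace ℝ (Fin 4)) (invFunOn η D) (η p))) :=
    (hasMFDerivAt_iff_hasFDerivAt.2 (L : EuclideanSpace ℝ (Fin 4) →L[ℝ] ℂ).hasFDerivAt).comp (η p)
      hg.hasMFDerivAt
  -- holomorphicity of `η⁻¹`: `d(η⁻¹) (JX w) = (i ⊕ i) (d(η⁻¹) w)` with `w = dη q`
  set q : EuclideanSpace ℝ (Fin 4) :=
    mfderiv (𝓡 4) 𝓘(ℝ, EuclideanSpace ℝ (Fin 4)) (invFunOn η D) (η p) w with hq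
  have hw : mfderiv 𝓘(ℝ, EuclideanSpace ℝ (Fin 4)) (𝓡 4) η p q = w :=
    mfderiv_apply_mfderiv_invFunOn' hD hη hinj hp w
  have hkey : mfderiv (𝓡 4) 𝓘(ℝ, EuclideanSpace ℝ (Fin 4)) (invFunOn η D) (η p) (JX (η p) w) =
      WithLp.toLp 2 ![-(q 1), q 0, -(q 3), q 2] := by
    rw [← hw, hhol p hp q, mfderiv_invFunOn_apply_mfderiv hD hη hinj hp]
  have happ : ∀ v : TangentSpace (𝓡 4) (η p),
      mfderiv (𝓡 4) 𝓘(ℝ, ℂ) (fun y => L (invFunOn η D y)) (η p) v =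
        L (mfderiv (𝓡 4) 𝓘(ℝ, EuclideanSpace ℝ (Fin 4)) (invFunOn η D) (η p) v) := fun v =>
    congrArg (fun T : TangentSpace (𝓡 4) (η p) →L[ℝ] ℂ => T v) hcomp.mfderiv
  -- unfold the `show ℂ from` wrappers, then compute
  dsimp only
  rw [happ, happ, hkey, ← hq, hL]

end FlatLeaves

/-- **Registered helper sub-goal `helper_chartCoordinatesHolomorphic`** (line `cross-cap-laurent`):
for a cap chart `η` of the wedge cap (`D ⊆ ℝ⁴` open, `η` an injective `C^∞` local diffeomorphism
on `D` with `JX ∘ dη = dη ∘ (i ⊕ i)`), the image `η '' D` is open and the two complex coordinates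
`y ↦ (η⁻¹ y) 0 + i (η⁻¹ y) 1`, `y ↦ (η⁻¹ y) 2 + i (η⁻¹ y) 3` (`η⁻¹ := Function.invFunOn η D`)
are `C^∞` on it and `JX`-holomorphic: `dT (JX w) = i · dT w`. [cite: McDuffSalamon2017, §2.5] -/
theorem helper_chartCoordinatesHolomorphic : ∀ (X : Type) [TopologicalSpace X] [ChartedSpace (EuclideanSpace ℝ (Fin 4)) X] [IsManifold (𝓡 4) ∞ X] (JX : ∀ y : X, TangentSpace (𝓡 4) y →L[ℝ] TangentSpace (𝓡 4) y) (η : EuclideanSpace ℝ (Fin 4) → X) (D : Set (EuclideanSpace ℝ (Fin 4))), IsOpen D → IsLocalDiffeomorphOn 𝓘(ℝ, EuclideanSpace ℝ (Fin 4)) (𝓡 4) ∞ η D → Set.InjOn η D → (∀ p ∈ D, ∀ q : EuclideanSpace ℝ (Fin 4), JX (η p) (mfderiv 𝓘(ℝ, EuclideanSpace ℝ (Fin 4)) (𝓡 4) η p q) = mfderiv 𝓘(ℝ, EuclideanSpace ℝ (Fin 4)) (𝓡 4) η p (WithLp.toLp 2 ![-(q 1), q 0, -(q 3), q 2])) → IsOpen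 (η '' D) ∧ ContMDiffOn (𝓡 4) 𝓘(ℝ, ℂ) ∞ (fun y => (⟨(Function.invFunOn η D y) 0, (Function.invFunOn η D y) 1⟩ : ℂ)) (η '' D) ∧ ContMDiffOn (𝓡 4) 𝓘(ℝ, ℂ) ∞ (fun y => (⟨(Function.invFunOn η D y) 2, (Function.invFunOn η D y) 3⟩ : ℂ)) (η '' D) ∧ (∀ y ∈ η '' D, ∀ w : TangentSpace (𝓡 4) y, (show ℂ from mfderiv (𝓡 4) 𝓘(ℝ, ℂ) (fun y => (⟨(Function.invFunOn η D y) 0, (Function.invFunOn η D y) 1⟩ : ℂ)) y (JX y w)) = Complex.I * (show ℂ from mfderiv (𝓡 4) 𝓘(ℝ, ℂ) (fun y => (⟨(Function.invFunOn η D y) 0, (Function.invFunOn η D y) 1⟩ : ℂ)) y w)) ∧ (∀ y ∈ η '' D, ∀ w : TangentSpace (𝓡 4) y, (show ℂ from mfderiv (𝓡 4) 𝓘(ℝ, ℂ) (fun y => (⟨(Function.invFunOn η D y) 2, (Function.invFunOn η D y) 3⟩ : ℂ)) y (JX y w)) = Complex.I * (show ℂ from mfderiv (𝓡 4) 𝓘(ℝ,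 ℂ) (fun y => (⟨(Function.invFunOn η D y) 2, (Function.invFunOn η D y) 3⟩ : ℂ)) y w)) := by
  intro X _ _ _ JX η D hD hη hinj hhol
  -- the two complex coordinates of `ℝ⁴ = ℂ²` as real continuous linear maps `ℝ⁴ →L[ℝ] ℂ`
  obtain ⟨L₁, hL₁⟩ : ∃ L : EuclideanSpace ℝ (Fin 4) →L[ℝ] ℂ,
      ∀ p : EuclideanSpace ℝ (Fin 4), L p = ⟨p 0, p 1⟩ :=
    ⟨Complex.equivRealProdCLM.symm.toContinuousLinearMap.comp
        ((PiLp.proj 2 (fun _ : Fin 4 => ℝ) 0).prod (PiLp.proj 2 (fun _ : Fin 4 => ℝ) 1)),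
      fun p => by apply Complex.ext <;> simp⟩
  obtain ⟨L₂, hL₂⟩ : ∃ L : EuclideanSpace ℝ (Fin 4) →L[ℝ] ℂ,
      ∀ p : EuclideanSpace ℝ (Fin 4), L p = ⟨p 2, p 3⟩ :=
    ⟨Complex.equivRealProdCLM.symm.toContinuousLinearMap.comp
        ((PiLp.proj 2 (fun _ : Fin 4 => ℝ) 2).prod (PiLp.proj 2 (fun _ : Fin 4 => ℝ) 3)),
      fun p => by apply Complex.ext <;> simp⟩
  -- they intertwine `i ⊕ i` with `i`
  have hI₁ : ∀ q : EuclideanSpace ℝ (Fin 4),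
      L₁ (WithLp.toLp 2 ![-(q 1), q 0, -(q 3), q 2]) = Complex.I * L₁ q := by
    intro q
    rw [hL₁, hL₁]
    apply Complex.ext <;> simp
  have hI₂ : ∀ q : EuclideanSpace ℝ (Fin 4),
      L₂ (WithLp.toLp 2 ![-(q 1), q 0, -(q 3), q 2]) = Complex.I * L₂ q := by
    intro q
    rw [hL₂, hL₂]
    apply Complex.ext <;> simp
  have hf₁ : (fun y => (⟨(Function.invFunOn η D y) 0, (Function.invFunOn η D y) 1⟩ : ℂ)) =
      fun y => L₁ (Function.invFunOn η D y) :=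
    funext fun y => (hL₁ _).symm
  have hf₂ : (fun y => (⟨(Function.invFunOn η D y) 2, (Function.invFunOn η D y) 3⟩ : ℂ)) =
      fun y => L₂ (Function.invFunOn η D y) :=
    funext fun y => (hL₂ _).symm
  rw [hf₁, hf₂]
  exact ⟨FlatLeaves.isOpen_image hD hη hinj,
    (FlatLeaves.contMDiffOn_and_hol_clm_comp_invFunOn hD hη hinj hhol L₁ hI₁).1,
    (FlatLeaves.contMDiffOn_and_hol_clm_comp_invFunOn hD hη hinj hhol L₂ hI₂).1,
    (FlatLeaves.contMDiffOn_and_hol_clm_comp_invFunOn hD hη hinj hhol L₁ hI₁).2,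
    (FlatLeaves.contMDiffOn_and_hol_clm_comp_invFunOn hD hη hinj hhol L₂ hI₂).2⟩

end Summit.SmoothPoincare4.SmoothPoincare4.Theorems.GromovRecognitionRelEnd.CrossCapLaurent
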